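import Summits.QuantumFields.YangMills.Theorems.AlphaInputsT3ACv3LinearLiftMatrixLift
import Summits.QuantumFields.YangMills.Theorems.AlphaInputsT3ACv3LinearLiftSmoothLin
import HarnessLib

/-!
# `AlphaInputsT3ACv3LinearLiftMatrixCLM` — (V) THE MATRIX-VALUED PORT OF THE (LL) ENGINE, PART 5: ★★ THE NEWTON PAIR `(T, R)` OF RULING g24-№4 AS CONTINUOUS LINEAR MAPS
# between the sup-normed spaces of `M_n(ℂ)`-valued lattice one-forms — `T = avgCLM` (the `k`-fold matrix linearised (0.4) average, `‖T‖ ≤ (d+1)·L^k`), `R = liftSCLM` (★w2 g2's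
# SUP-SMALL exact lift `liftS` ported, `‖R‖ ≤ C_S∕L^k`, `C_S = 18^d(2 + (d+1)18^d)`), `T ∘ R = id` EXACTLY, `‖T‖·‖R‖ ≤ (d+1)·C_S` k-UNIFORM, curl of `R u` ≤ `4·18^d·‖u‖∕L^{2k}` —
# the hypotheses `hR` (κ = 0), `‖R‖`, `p (R u) ≤ M‖u‖` of ★w4's `…v3NewtonShell.exists_zero_in_range_of_approxRightInverse` BY NAME — cell `ym3-torus`, seat `ym-ust-19936-w3` (g0)

WHY.  RULING g24-№4 (ym3-torus STATUS 2026-08-28T00:44:44Z): (FL)_non-ab ⇐ `hLift` ⇐ Newton∕IFT on the (LL) engine; ★w4-19936's shell (`…v3NewtonShell`, p-landed 00:54Z) is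
stated for Banach spaces `E`, `G`, a bounded linear `T : E →L G`, a right inverse `R : G →L E` with `‖T (R u) − u‖ ≤ κ‖u‖`, the operator norm `‖R‖`, and a seminorm row
`p (R u) ≤ M·‖u‖`; ★w2-19936 g2 landed the SUP-SMALL exact scalar lift `LinearLiftSpread.liftS` (`linAvgIter_liftS`, `curlAt_liftS = S2 ∘ curl`, ★ `abs_liftS_le : |liftS k A| ≤
C_S·M∕L^k`, `liftSL` linear; `…LinearLiftSmooth(Lin)`), answering the located sup-smallness gap (BCH commutator floor of non-sup-small lifts, alpha-2 g5 01:04:57Z (c)).  THIS FILE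
assembles the pair in the currency of the non-abelian candidates, using parts 1–2 (`byEntry`, kernel form, `norm_byEntry_le_of_bound`, `linAvgIterM`):
* §11 `byEntryL T` (the entrywise extension of a LINEAR scalar operator is `ℝ`-linear in the matrix field) and `byEntryCLM T C` (continuous for the sup norms with `‖·‖ ≤ C`
  whenever `T` has the scalar `ℓ^∞` bound `C` — `norm_byEntryCLM_le`).
* §12 `liftSM k := byEntry (liftS k)`: EXACTNESS `linAvgIterM_liftSM`, `liftSM_mem` (`𝔰𝔲(N)`-valued), ★ `norm_liftSM_le` (`≤ (C_S∕L^k)·M`, SAME constant as the scalar theorem),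
  `curlM_liftSM_eq_sum`, ★ `norm_curlM_liftSM_le_local` (`18^d·ε∕(L^k)²` from the `Near` cells only), `norm_curlM_le_four_mul_norm` (`‖curlM u‖ ≤ 4‖u‖_sup`).
* §13 ★★ the CLMs `avgCLM P k : (PBond P 0 → M_n(ℂ)) →L[ℝ] (PBond P k → M_n(ℂ))` and `liftSCLM P k hk` in the other direction, with `avgCLM_apply = linAvgIterM k`,
  `liftSCLM_apply = liftSM k`, ★★ `avgCLM_liftSCLM : avgCLM P k (liftSCLM P k hk u) = u` (so w4's `hR` holds with `κ = 0`: `norm_avgCLM_liftSCLM_sub_le`), ★ `norm_avgCLM_le`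
  (`≤ (d+1)·L^k`), ★ `norm_liftSCLM_le` (`≤ C_S∕L^k`), ★★ `norm_avgCLM_mul_norm_liftSCLM_le` (`‖T‖·‖R‖ ≤ (d+1)·C_S`, NO `k`: the `L^k` of the average is exactly compensated by the
  `L^{−k}` of the sup-small lift — the k-UNIFORMITY the ruling names), ★ `norm_curlM_liftSCLM_le` (`‖curlM (R u) x μ ν‖ ≤ (4·18^d∕(L^k)²)·‖u‖`: the curl row `p (R u) ≤ M‖u‖`),
  `liftSCLM_mem` (`𝔰𝔲(N)`-valued data ↦ `𝔰𝔲(N)`-valued fields).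
HONEST FRAMING.  Finite-dimensional real linear algebra; the NONLINEAR map `Φ` of the Newton shell (the `k`-fold (0.4)∕EML average composed with `exp`, its two-field Lipschitz
remainder — ★w1's (c)) is NOT here; nothing of [Balaban1985UV3]∕[Balaban1985Variational]∕[Balaban1985Averaging] is asserted; (FL), the stub 2′χ, the crux `HistoryTailL` and any
gap are NOT claimed; count-neutral helper (`--supports stmt-QuantumFields-19936`); registry untouched.  YM₃ on the three-torus is a RUNG of the programme, not the Clay problem;
nothing here is about d = 4, infinite volume or a mass gap.

References: T. Bałaban, Commun. Math. Phys. 109 (1987) 249–301 [Balaban1987RG1] ((0.4), (0.11) p.253); Commun. Math. Phys. 98 (1985) 17–51 [Balaban1985Averaging] ((125) p.36,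
Prop. 4 (130)–(131) p.38); B. C. Hall, Lie Groups, Lie Algebras, and Representations (2015) [Hall2015] (Example 7.3).
-/

set_option autoImplicit false

noncomputable section

open scoped Matrix.Norms.L2Operator

namespace Summit.QuantumFields.YangMills.Theorems.LinearLiftMatrix

open Finset
open Literature.MathematicalPhysics.QuantumFieldTheory.Balaban1983to89
open Literature.MathematicalPhysics.QuantumFieldTheory.Balaban1985CMP102.Setting
open Summit.QuantumFields.Balaban3D.Carriers
open Summit.QuantumFields.YangMills.Theorems.AbelianEML (linAvgIter curlAt)
open Summit.QuantumFields.YangMills.Theorems.LinearLiftProfile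
open Summit.QuantumFields.YangMills.Theorems.LinearLiftSpread (hh S2 liftS liftSL liftSL_apply linAvgIter_liftS curlAt_liftS abs_liftS_le Near weight_eq_zero_of_not_near near_self)
open Summit.QuantumFields.YangMills.Theorems.LinearAvgSup (abs_linAvgIter_le)

/-! ## §11 The entrywise extension as a (continuous) linear map of the matrix field -/

section Linear

variable {n : Type*} {ι κ : Type*} [Fintype ι]

/-- **THE ENTRYWISE EXTENSION OF A LINEAR OPERATOR IS `ℝ`-LINEAR IN THE MATRIX FIELD.** [folklore] -/
def byEntryL (T : (ι → ℝ) →ₗ[ℝ] (κ → ℝ)) : (ι → Matrix n n ℂ) →ₗ[ℝ] (κ → Matrix n n ℂ) where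
  toFun := byEntry T
  map_add' A B := by
    classical
    funext b
    rw [Pi.add_apply, byEntry_eq_sum_kernel, byEntry_eq_sum_kernel, byEntry_eq_sum_kernel, ← sum_add_distrib]
    exact sum_congr rfl fun c _ => by rw [Pi.add_apply, smul_add]
  map_smul' r A := by
    classical
    funext b
    rw [RingHom.id_apply, Pi.smul_apply, byEntry_eq_sum_kernel, byEntry_eq_sum_kernel, smul_sum]
    exact sum_congr rfl fun c _ => by rw [Pi.smul_apply, smul_comm]

/-- `byEntryL T A = byEntry T A`. [folklore] -/
@[simp] theorem byEntryL_apply (T : (ι → ℝ) →ₗ[ℝ] (κ → ℝ)) (A : ι → Matrix n n ℂ) : byEntryL T A = byEntry T A := rfl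

variable [Fintype κ] [Fintype n] [DecidableEq n]

/-- **THE ENTRYWISE EXTENSION AS A CONTINUOUS LINEAR MAP FOR THE SUP NORMS**, from a scalar `ℓ^∞` bound `|T f (b)| ≤ C·sup|f|`. [folklore] -/
def byEntryCLM (T : (ι → ℝ) →ₗ[ℝ] (κ → ℝ)) (C : ℝ) (hC : 0 ≤ C) (hT : ∀ (f : ι → ℝ) (M : ℝ), (∀ c, |f c| ≤ M) → ∀ b, |T f b| ≤ C * M) :
    (ι → Matrix n n ℂ) →L[ℝ] (κ → Matrix n n ℂ) :=
  (byEntryL T).mkContinuous C fun A => by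
    classical
    rw [byEntryL_apply, pi_norm_le_iff_of_nonneg (mul_nonneg hC (norm_nonneg A))]
    intro b
    exact norm_byEntry_le_of_bound T (fun _ => True) b (fun f M hf => hT f M (fun c => hf c trivial) b) A (norm_nonneg A) fun c _ => norm_le_pi_norm A c

/-- `byEntryCLM T C … A = byEntry T A`. [folklore] -/
@[simp] theorem byEntryCLM_apply (T : (ι → ℝ) →ₗ[ℝ] (κ → ℝ)) (C : ℝ) (hC : 0 ≤ C) (hT : ∀ (f : ι → ℝ) (M : ℝ), (∀ c, |f c| ≤ M) → ∀ b, |T f b| ≤ C * M)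
    (A : ι → Matrix n n ℂ) : byEntryCLM T C hC hT A = byEntry T A := rfl

/-- **★ THE OPERATOR NORM OF THE PORT IS AT MOST THE SCALAR `ℓ^∞` CONSTANT.** [folklore] -/
theorem norm_byEntryCLM_le (T : (ι → ℝ) →ₗ[ℝ] (κ → ℝ)) (C : ℝ) (hC : 0 ≤ C) (hT : ∀ (f : ι → ℝ) (M : ℝ), (∀ c, |f c| ≤ M) → ∀ b, |T f b| ≤ C * M) :
    ‖(byEntryCLM T C hC hT : (ι → Matrix n n ℂ) →L[ℝ] (κ → Matrix n n ℂ))‖ ≤ C :=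
  LinearMap.mkContinuous_norm_le _ hC _

end Linear

/-! ## §12 The sup-small matrix lift `liftSM` -/

section LiftS

variable {P : Params} {n : Type*}

/-- **THE SUP-SMALL MATRIX LIFT**: ★w2 g2's `liftS k` on the real and imaginary part of every entry. [cite: Balaban1987RG1, (0.4)+(0.11) p.253] -/
def liftSM (k : ℕ) (A : PBond P k → Matrix n n ℂ) : PBond P 0 → Matrix n n ℂ := byEntry (liftS k) A

/-- `liftSM k = byEntry (liftS k)`. [cite: Balaban1987RG1, (0.4)+(0.11) p.253] -/
theorem liftSM_eq (k : ℕ) (A : PBond P k → Matrix n n ℂ) : liftSM k A = byEntry (liftS k) A := rfl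

/-- The real `C_S = 18^d (2 + (d+1) 18^d)` of `abs_liftS_le`. [cite: Balaban1987RG1, (0.4)+(0.11) p.253] -/
def CS (P : Params) : ℝ := (18 : ℝ) ^ P.d * (2 + ((P.d : ℝ) + 1) * (18 : ℝ) ^ P.d)

/-- `0 ≤ C_S`. [folklore] -/
theorem CS_nonneg (P : Params) : 0 ≤ CS P := by unfold CS; positivity

variable (k : ℕ) (hk : k ≤ P.m + P.K)
include hk

/-- **★★ EXACTNESS**: `linAvgIterM k (liftSM k A) = A` on EVERY coarse bond. [cite: Balaban1987RG1, (0.4)+(0.11) p.253] -/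
theorem linAvgIterM_liftSM [Fintype n] [DecidableEq n] [Nonempty n] (A : PBond P k → Matrix n n ℂ) : linAvgIterM k (liftSM k A) = A := by
  rw [linAvgIterM_eq_byEntry, liftSM_eq, byEntry_comp]
  have h : ((linAvgIter k) ∘ (liftS k) : (PBond P k → ℝ) → (PBond P k → ℝ)) = id := funext fun f => linAvgIter_liftS k hk f
  rw [h, byEntry_id]

omit hk in
/-- **★ `𝔰𝔲(N)`-VALUED DATA LIFT TO `𝔰𝔲(N)`-VALUED FIELDS** (any `ℝ`-submodule). [cite: Hall2015, Example 7.3] -/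
theorem liftSM_mem (S : Submodule ℝ (Matrix n n ℂ)) {A : PBond P k → Matrix n n ℂ} (hA : ∀ c, A c ∈ S) (b : PBond P 0) : liftSM k A b ∈ S := by
  classical
  rw [liftSM_eq, byEntry_congr (T := liftS k) (fun f => (liftSL_apply k f).symm)]
  exact byEntry_mem (liftSL P k) S hA b

/-- The scalar sup bound in product form: `|liftS k f (b)| ≤ (C_S ∕ L^k)·M`. [cite: Balaban1987RG1, (0.4)+(0.11) p.253] -/
theorem abs_liftS_le' (f : PBond P k → ℝ) {M : ℝ} (hf : ∀ c, |f c| ≤ M) (b : PBond P 0) : |liftS k f b| ≤ (CS P / (P.L : ℝ) ^ k) * M := by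
  have h := abs_liftS_le k hk f hf b
  unfold CS
  calc |liftS k f b| ≤ (18 : ℝ) ^ P.d * (2 + ((P.d : ℝ) + 1) * (18 : ℝ) ^ P.d) * M / (P.L : ℝ) ^ k := h
    _ = (18 : ℝ) ^ P.d * (2 + ((P.d : ℝ) + 1) * (18 : ℝ) ^ P.d) / (P.L : ℝ) ^ k * M := by ring

/-- **★ THE k-UNIFORM, `L^{−k}`-SMALL SUP BOUND OF THE MATRIX LIFT, SAME CONSTANT AS THE SCALAR THEOREM**: `‖A c‖ ≤ M` ⇒ `‖liftSM k A b‖ ≤ (C_S ∕ L^k)·M`.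
[cite: Balaban1987RG1, (0.4)+(0.11) p.253] -/
theorem norm_liftSM_le [Fintype n] [DecidableEq n] (A : PBond P k → Matrix n n ℂ) {M : ℝ} (hA : ∀ c, ‖A c‖ ≤ M) (b : PBond P 0) :
    ‖liftSM k A b‖ ≤ (CS P / (P.L : ℝ) ^ k) * M := by
  classical
  have hM : 0 ≤ M := (norm_nonneg _).trans (hA ⟨fun _ => 0, b.dir⟩)
  rw [liftSM_eq, byEntry_congr (T := liftS k) (fun f => (liftSL_apply k f).symm)]
  exact norm_byEntry_le_of_bound (liftSL P k) (fun _ => True) b (fun f M' hf => abs_liftS_le' k hk f (fun c => hf c trivial) b) A hM fun c _ => hA c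

/-- **THE MATRIX CURL OF THE SUP-SMALL MATRIX LIFT IS THE `S²`-SPREAD OF THE COARSE MATRIX CURLS** (entrywise `curlAt_liftS`). [cite: Balaban1987RG1, (0.4) p.253] -/
theorem curlM_liftSM_eq_sum (A : PBond P k → Matrix n n ℂ) (x : Site P 0) {μ ν : Fin P.d} (hμν : μ ≠ ν) :
    curlM (liftSM k A) x μ ν = ∑ y, (wS2 k x μ ν y) • curlM A y μ ν := by
  ext i l
  apply Complex.ext
  · rw [curlM_apply_re, Matrix.sum_apply, Complex.re_sum]
    have h : (fun b => (liftSM k A b i l).re) = liftS k (fun c => (A c i l).re) := funext fun b => byEntry_apply_re _ _ _ _ _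
    rw [h, curlAt_liftS k hk _ x hμν, S2_eq_sum_wS2]
    refine sum_congr rfl fun y _ => ?_
    rw [Matrix.smul_apply, Complex.smul_re, smul_eq_mul, curlM_apply_re]
  · rw [curlM_apply_im, Matrix.sum_apply, Complex.im_sum]
    have h : (fun b => (liftSM k A b i l).im) = liftS k (fun c => (A c i l).im) := funext fun b => byEntry_apply_im _ _ _ _ _
    rw [h, curlAt_liftS k hk _ x hμν, S2_eq_sum_wS2]
    refine sum_congr rfl fun y _ => ?_
    rw [Matrix.smul_apply, Complex.smul_im, smul_eq_mul, curlM_apply_im]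

/-- **★ THE LOCAL CURL BOUND OF THE SUP-SMALL MATRIX LIFT**: `‖curlM (liftSM k A) x μ ν‖ ≤ 18^d·ε∕(L^k)²` from `‖curlM A y μ ν‖ ≤ ε` at the coarse `y` NEAR `x` only.
[cite: Balaban1987RG1, (0.4) p.253; Balaban1985Variational, Thm 1 (8) p.279] -/
theorem norm_curlM_liftSM_le_local [Fintype n] [DecidableEq n] (A : PBond P k → Matrix n n ℂ) (x : Site P 0) {μ ν : Fin P.d} (hμν : μ ≠ ν) {ε : ℝ}
    (hA : ∀ y : Site P k, Near k x y → ‖curlM A y μ ν‖ ≤ ε) :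
    ‖curlM (liftSM k A) x μ ν‖ ≤ (18 : ℝ) ^ P.d * ε / ((P.L : ℝ) ^ k) ^ 2 := by
  have hε : 0 ≤ ε := (norm_nonneg _).trans (hA _ (near_self k hk x))
  rw [curlM_liftSM_eq_sum k hk A x hμν]
  have hterm : ∀ y, ‖(wS2 k x μ ν y) • curlM A y μ ν‖ ≤ |wS2 k x μ ν y| * ε := fun y => by
    rw [norm_smul, Real.norm_eq_abs]
    by_cases hy : Near k x y
    · exact mul_le_mul_of_nonneg_left (hA y hy) (abs_nonneg _)
    · rw [show wS2 k x μ ν y = 0 from weight_eq_zero_of_not_near k x y μ ν hμν hy, abs_zero, zero_mul, zero_mul]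
  calc ‖∑ y, (wS2 k x μ ν y) • curlM A y μ ν‖ ≤ ∑ y, |wS2 k x μ ν y| * ε := norm_sum_le_of_le _ fun y _ => hterm y
    _ = (∑ y, |wS2 k x μ ν y|) * ε := by rw [sum_mul]
    _ ≤ ((18 : ℝ) ^ P.d * 1 / ((P.L : ℝ) ^ k) ^ 2) * ε := mul_le_mul_of_nonneg_right (sum_abs_wS2_le k hk x hμν) hε
    _ = (18 : ℝ) ^ P.d * ε / ((P.L : ℝ) ^ k) ^ 2 := by ring

omit hk in
/-- `‖curlM u y μ ν‖ ≤ 4·‖u‖` for the sup norm of the one-form. [folklore] -/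
theorem norm_curlM_le_four_mul_norm [Fintype n] [DecidableEq n] {j : ℕ} (u : PBond P j → Matrix n n ℂ) (y : Site P j) (μ ν : Fin P.d) :
    ‖curlM u y μ ν‖ ≤ 4 * ‖u‖ := by
  unfold curlM
  have h := norm_le_pi_norm u
  calc ‖u ⟨y, μ⟩ + u ⟨y.shift μ, ν⟩ - u ⟨y.shift ν, μ⟩ - u ⟨y, ν⟩‖
      ≤ ‖u ⟨y, μ⟩‖ + ‖u ⟨y.shift μ, ν⟩‖ + ‖u ⟨y.shift ν, μ⟩‖ + ‖u ⟨y, ν⟩‖ := by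
        refine (norm_sub_le _ _).trans ?_
        refine add_le_add ((norm_sub_le _ _).trans (add_le_add (norm_add_le _ _) le_rfl)) le_rfl
    _ ≤ ‖u‖ + ‖u‖ + ‖u‖ + ‖u‖ := by gcongr <;> exact h _
    _ = 4 * ‖u‖ := by ring

end LiftS

/-! ## §13 The Newton pair `(T, R) = (avgCLM, liftSCLM)` -/

section CLM

variable (P : Params) {n : Type*} [Fintype n] [DecidableEq n]

/-- **`T`: THE `k`-FOLD MATRIX LINEARISED (0.4) AVERAGE AS A CONTINUOUS LINEAR MAP** for the sup norms, `‖T‖ ≤ (d+1)·L^k` (w1's `abs_linAvgIter_le` ported).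
[cite: Balaban1987RG1, (0.11) p.253; Balaban1985Averaging, Prop. 4 (130)–(131) p.38] -/
def avgCLM (k : ℕ) : (PBond P 0 → Matrix n n ℂ) →L[ℝ] (PBond P k → Matrix n n ℂ) :=
  byEntryCLM (linAvgIterL P k) (((P.d : ℝ) + 1) * (P.L : ℝ) ^ k) (by positivity) fun f M hf c => abs_linAvgIter_le f hf k c

/-- **`R`: THE SUP-SMALL EXACT MATRIX LIFT AS A CONTINUOUS LINEAR MAP** for the sup norms, `‖R‖ ≤ C_S∕L^k` (★w2 g2's `abs_liftS_le` ported).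
[cite: Balaban1987RG1, (0.4)+(0.11) p.253] -/
def liftSCLM (k : ℕ) (hk : k ≤ P.m + P.K) : (PBond P k → Matrix n n ℂ) →L[ℝ] (PBond P 0 → Matrix n n ℂ) :=
  byEntryCLM (liftSL P k) (CS P / (P.L : ℝ) ^ k) (div_nonneg (CS_nonneg P) (by positivity)) fun f M hf b => abs_liftS_le' k hk f hf b

variable {P}
variable (k : ℕ) (hk : k ≤ P.m + P.K)

/-- `avgCLM P k a = linAvgIterM k a`. [cite: Balaban1987RG1, (0.11) p.253] -/
theorem avgCLM_apply [Nonempty n] (a : PBond P 0 → Matrix n n ℂ) : avgCLM P k a = linAvgIterM k a := by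
  rw [avgCLM, byEntryCLM_apply, linAvgIterM_eq_byEntry]
  exact byEntry_congr (fun f => linAvgIterL_apply k f) a

/-- `liftSCLM P k hk u = liftSM k u`. [cite: Balaban1987RG1, (0.4)+(0.11) p.253] -/
theorem liftSCLM_apply (u : PBond P k → Matrix n n ℂ) : liftSCLM P k hk u = liftSM k u := by
  rw [liftSCLM, byEntryCLM_apply, liftSM_eq]
  exact byEntry_congr (fun f => liftSL_apply k f) u

/-- **★★ `T ∘ R = id` EXACTLY**: `avgCLM P k (liftSCLM P k hk u) = u`. [cite: Balaban1987RG1, (0.4)+(0.11) p.253] -/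
theorem avgCLM_liftSCLM [Nonempty n] (u : PBond P k → Matrix n n ℂ) : avgCLM P k (liftSCLM P k hk u) = u := by
  rw [avgCLM_apply, liftSCLM_apply, linAvgIterM_liftSM k hk]

/-- `T ∘L R = id` as continuous linear maps. [cite: Balaban1987RG1, (0.4)+(0.11) p.253] -/
theorem avgCLM_comp_liftSCLM [Nonempty n] : (avgCLM P k).comp (liftSCLM P k hk) = ContinuousLinearMap.id ℝ (PBond P k → Matrix n n ℂ) := by
  ext1 u
  exact avgCLM_liftSCLM k hk u

/-- **w4's `hR` WITH `κ = 0`**: `‖T (R u) − u‖ ≤ 0·‖u‖`. [folklore] -/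
theorem norm_avgCLM_liftSCLM_sub_le [Nonempty n] (u : PBond P k → Matrix n n ℂ) : ‖avgCLM P k (liftSCLM P k hk u) - u‖ ≤ 0 * ‖u‖ := by
  rw [avgCLM_liftSCLM k hk, sub_self, norm_zero, zero_mul]

omit hk in
/-- **★ `‖T‖ ≤ (d+1)·L^k`.** [cite: Balaban1985Averaging, Prop. 4 (130)–(131) p.38] -/
theorem norm_avgCLM_le : ‖(avgCLM P k : (PBond P 0 → Matrix n n ℂ) →L[ℝ] (PBond P k → Matrix n n ℂ))‖ ≤ ((P.d : ℝ) + 1) * (P.L : ℝ) ^ k :=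
  norm_byEntryCLM_le _ _ _ _

/-- **★ `‖R‖ ≤ C_S ∕ L^k`.** [cite: Balaban1987RG1, (0.4)+(0.11) p.253] -/
theorem norm_liftSCLM_le : ‖(liftSCLM P k hk : (PBond P k → Matrix n n ℂ) →L[ℝ] (PBond P 0 → Matrix n n ℂ))‖ ≤ CS P / (P.L : ℝ) ^ k :=
  norm_byEntryCLM_le _ _ _ _

/-- **★★ `‖T‖·‖R‖ ≤ (d+1)·C_S` — k-UNIFORM**: the `L^k` of the average is exactly compensated by the `L^{−k}` of the sup-small lift. [cite: Balaban1987RG1, (0.4)+(0.11) p.253] -/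
theorem norm_avgCLM_mul_norm_liftSCLM_le :
    ‖(avgCLM P k : (PBond P 0 → Matrix n n ℂ) →L[ℝ] (PBond P k → Matrix n n ℂ))‖ *
        ‖(liftSCLM P k hk : (PBond P k → Matrix n n ℂ) →L[ℝ] (PBond P 0 → Matrix n n ℂ))‖ ≤ ((P.d : ℝ) + 1) * CS P := by
  have hL : (0 : ℝ) < (P.L : ℝ) ^ k := by have := P.L_pos; positivity
  calc _ ≤ (((P.d : ℝ) + 1) * (P.L : ℝ) ^ k) * (CS P / (P.L : ℝ) ^ k) :=
        mul_le_mul (norm_avgCLM_le k) (norm_liftSCLM_le k hk) (ContinuousLinearMap.opNorm_nonneg _) (by positivity)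
    _ = ((P.d : ℝ) + 1) * CS P := by field_simp

/-- **★ THE CURL ROW `p (R u) ≤ M·‖u‖`**: `‖curlM (liftSCLM P k hk u) x μ ν‖ ≤ (4·18^d∕(L^k)²)·‖u‖` at EVERY finest site (global form; the `Near`-local form is
`norm_curlM_liftSM_le_local`). [cite: Balaban1987RG1, (0.4) p.253; Balaban1985Variational, Thm 1 (8) p.279] -/
theorem norm_curlM_liftSCLM_le (u : PBond P k → Matrix n n ℂ) (x : Site P 0) {μ ν : Fin P.d} (hμν : μ ≠ ν) :
    ‖curlM (liftSCLM P k hk u) x μ ν‖ ≤ (4 * (18 : ℝ) ^ P.d / ((P.L : ℝ) ^ k) ^ 2) * ‖u‖ := by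
  rw [liftSCLM_apply]
  have h := norm_curlM_liftSM_le_local k hk u x hμν (ε := 4 * ‖u‖) fun y _ => norm_curlM_le_four_mul_norm u y μ ν
  calc ‖curlM (liftSM k u) x μ ν‖ ≤ (18 : ℝ) ^ P.d * (4 * ‖u‖) / ((P.L : ℝ) ^ k) ^ 2 := h
    _ = (4 * (18 : ℝ) ^ P.d / ((P.L : ℝ) ^ k) ^ 2) * ‖u‖ := by ring

/-- **`R` MAPS `𝔰𝔲(N)`-VALUED DATA TO `𝔰𝔲(N)`-VALUED FIELDS** (any `ℝ`-submodule). [cite: Hall2015, Example 7.3] -/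
theorem liftSCLM_mem (S : Submodule ℝ (Matrix n n ℂ)) {u : PBond P k → Matrix n n ℂ} (hu : ∀ c, u c ∈ S) (b : PBond P 0) : liftSCLM P k hk u b ∈ S := by
  rw [liftSCLM_apply]
  exact liftSM_mem k S hu b

omit hk in
/-- **`T` MAPS `𝔰𝔲(N)`-VALUED FIELDS TO `𝔰𝔲(N)`-VALUED DATA** (any `ℝ`-submodule). [cite: Hall2015, Example 7.3] -/
theorem avgCLM_mem [Nonempty n] (S : Submodule ℝ (Matrix n n ℂ)) {a : PBond P 0 → Matrix n n ℂ} (ha : ∀ b, a b ∈ S) (c : PBond P k) : avgCLM P k a c ∈ S := by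
  rw [avgCLM_apply]
  exact linAvgIterM_mem k S ha c

end CLM

end Summit.QuantumFields.YangMills.Theorems.LinearLiftMatrix

end
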